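import Literature.NumberTheory.LFunctions.ConreyIwaniec2002OffDiagPhiL2
import Literature.Analysis.FunctionSpaces.PlancherelL1L2
import HarnessLib

/-!
# Conrey–Iwaniec (2002), Proposition 6.4, off-diagonal main term: the Mellin pairing (part 1 of stub S5 of SKELETON P64)

B. Conrey, H. Iwaniec, Acta Arith. 103 (2002), §6 (6.29)–(6.35), (6.39) [held text
`paper:arxiv-math_0111012`, p0015–p0016]. The term `2T∫₀^∞|a(y)|²D(T/y)dy/y` of (6.39), with
`D(v) = Σ_h σ(h)L(hv)` for the coefficients `σ` of a genus character, is bounded ABSOLUTELY: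
`|∫₀^∞ |a(y)|² D(T/y) dy/y| ≤ c·ℓ²·(log q)²` — the integrated and repaired form of (6.34)–(6.35)
(line card R-c / finding F-P64-α of the cell landau-siegel/ls-inputs, line `thm61-cm-convolution`).
Proof: `D = 𝓜⁻¹_{σ₀}Φ` (`OffDiagMellin.ciD_eq_mellinInv_genusPhi`, `σ₀ = 1/(2 log q)`), Fubini against
the Mellin transform of `|a|²`, Cauchy–Schwarz in `t` with the mean-square bound of `Φ`
(`OffDiagPhiL2.exists_integral_norm_sq_genusPhi_le`) and Plancherel for `𝓜|a|²`
(tree `Literature.Analysis.FunctionSpaces.integral_norm_sq_fourierIntegral_eq` through Mathlib's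
`mellin_eq_fourier`).

PROVED HERE (part 1): the weight bounds for `A = |a|²`, the Mellin–Plancherel bound
`∫|𝓜A(σ₀+it)|²dt ≤ 2π(1/(2σ₀)+1)Y^{2σ₀}` and the Fubini pairing identity
`OffDiagonal.integral_normSq_ciD_eq`; the bound itself (`offdiagonal_genus_bound` = stub S5) is in
`ConreyIwaniec2002OffDiagonal.lean`.

## References
* [ConreyIwaniec2002] B. Conrey, H. Iwaniec, Acta Arith. 103 (2002) 259–312: §6 (6.29)–(6.35), (6.39).
-/

noncomputable section

open Complex MeasureTheory Set Filter Real
open scoped Topology FourierTransform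

namespace Literature.NumberTheory.LFunctions

namespace ConreyIwaniec2002

namespace OffDiagonal

open KernelMellin GenusZFactorBounds OffDiagMellin OffDiagPhiL2

/-! ### The weight `A(y) = |a(y)|²` and its Mellin transform on `Re s = σ₀` -/

section Weight

variable {a : ℝ → ℂ} {T Y : ℝ} (hT : 2 ≤ T) (hTY : T ≤ Y) (ha : IsCutoff a T Y)
include hT hTY ha

/-- `|a(y)|² ≤ 1`, `≤ (y/T)⁸`, `≤ (Y/y)⁸` on `y > 0`. [cite: ConreyIwaniec2002, §6 (6.38)] -/
theorem normSq_cutoff_le {y : ℝ} (hy : 0 < y) :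
    ‖a y‖ ^ 2 ≤ 1 ∧ ‖a y‖ ^ 2 ≤ (y / T) ^ 8 ∧ ‖a y‖ ^ 2 ≤ (Y / y) ^ 8 := by
  have hT0 : 0 < T := by linarith
  have hY0 : 0 < Y := by linarith
  have h0 := ha.2 0 (by norm_num) y hy
  simp only [pow_zero, iteratedDeriv_zero, one_mul] at h0
  have hb : 1 ≤ 1 + y / Y + T / y := by
    have : 0 ≤ y / Y := by positivity
    have : 0 ≤ T / y := by positivity
    linarith
  have hn : 0 ≤ ‖a y‖ := norm_nonneg _
  have hbase : 0 < 1 + y / Y + T / y := by linarith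
  -- `‖a y‖ ≤ B⁻¹` with `B = (1 + y/Y + T/y)^4`
  have h1 : ‖a y‖ ≤ 1 := h0.trans (inv_le_one_of_one_le₀ (one_le_pow₀ hb))
  have h2 : ‖a y‖ ≤ (y / T) ^ 4 := by
    refine h0.trans ?_
    have : T / y ≤ 1 + y / Y + T / y := by
      have : 0 ≤ y / Y := by positivity
      linarith
    calc ((1 + y / Y + T / y) ^ 4)⁻¹ ≤ ((T / y) ^ 4)⁻¹ :=
          inv_anti₀ (by positivity) (pow_le_pow_left₀ (by positivity) this 4)
      _ = (y / T) ^ 4 := by rw [← inv_pow, inv_div]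
  have h3 : ‖a y‖ ≤ (Y / y) ^ 4 := by
    refine h0.trans ?_
    have : y / Y ≤ 1 + y / Y + T / y := by
      have : 0 ≤ T / y := by positivity
      linarith
    calc ((1 + y / Y + T / y) ^ 4)⁻¹ ≤ ((y / Y) ^ 4)⁻¹ :=
          inv_anti₀ (by positivity) (pow_le_pow_left₀ (by positivity) this 4)
      _ = (Y / y) ^ 4 := by rw [← inv_pow, inv_div]
  refine ⟨by nlinarith, ?_, ?_⟩
  · calc ‖a y‖ ^ 2 ≤ ((y / T) ^ 4) ^ 2 := pow_le_pow_left₀ hn h2 2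
      _ = (y / T) ^ 8 := by ring
  · calc ‖a y‖ ^ 2 ≤ ((Y / y) ^ 4) ^ 2 := pow_le_pow_left₀ hn h3 2
      _ = (Y / y) ^ 8 := by ring

omit hT hTY in
/-- `y ↦ |a(y)|²` is continuous on `(0,∞)`. [cite: ConreyIwaniec2002, §6 (6.38)] -/
theorem continuousOn_normSq_cutoff : ContinuousOn (fun y : ℝ => ‖a y‖ ^ 2) (Ioi 0) :=
  (ha.1.continuousOn.norm).pow 2

end Weight

/-! ### Change of variables `y = e^{-u}` and the Mellin–Plancherel bound for `𝓜|a|²` -/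

section MellinWeight

variable {a : ℝ → ℂ} {T Y : ℝ} (hT : 2 ≤ T) (hTY : T ≤ Y) (ha : IsCutoff a T Y)
include hT hTY ha

/-- `∫₀^∞ y^{c-1}|a(y)|^{2k} dy ≤ (1/c + 1) Y^c` for `k = 1, 2`, `0 < c ≤ 1`: on `(0,Y]` use
`|a| ≤ 1`, beyond use `|a|² ≤ (Y/y)⁸`. [cite: ConreyIwaniec2002, §6 (6.38)] -/
theorem integral_rpow_mul_normSq_pow_le {c : ℝ} (hc : 0 < c) (hc1 : c ≤ 1) {k : ℕ} (hk : 1 ≤ k) :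
    IntegrableOn (fun y : ℝ => y ^ (c - 1) * (‖a y‖ ^ 2) ^ k) (Ioi 0) ∧
      ∫ y in Ioi (0:ℝ), y ^ (c - 1) * (‖a y‖ ^ 2) ^ k ≤ (1 / c + 1) * Y ^ c := by
  have hT0 : 0 < T := by linarith
  have hY0 : 0 < Y := by linarith
  -- pointwise bounds
  have hb1 : ∀ y, 0 < y → (‖a y‖ ^ 2) ^ k ≤ 1 := fun y hy =>
    pow_le_one₀ (by positivity) (normSq_cutoff_le hT hTY ha hy).1
  have hb2 : ∀ y, 0 < y → (‖a y‖ ^ 2) ^ k ≤ (Y / y) ^ 8 := fun y hy => by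
    have h := (normSq_cutoff_le hT hTY ha hy)
    calc (‖a y‖ ^ 2) ^ k ≤ (‖a y‖ ^ 2) ^ 1 := pow_le_pow_of_le_one (by positivity) h.1 hk
      _ = ‖a y‖ ^ 2 := pow_one _
      _ ≤ (Y / y) ^ 8 := h.2.2
  have hcont : ContinuousOn (fun y : ℝ => y ^ (c - 1) * (‖a y‖ ^ 2) ^ k) (Ioi 0) := by
    refine ContinuousOn.mul (fun y hy => ?_) ((continuousOn_normSq_cutoff ha).pow k)
    exact (Real.continuousAt_rpow_const _ _ (Or.inl (ne_of_gt hy))).continuousWithinAt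
  have hnn : ∀ y, 0 < y → 0 ≤ y ^ (c - 1) * (‖a y‖ ^ 2) ^ k := fun y hy => by positivity
  -- piece 1: `(0, Y]`, dominated by `y^{c-1}`
  have hI1 : IntegrableOn (fun y : ℝ => y ^ (c - 1)) (Ioc 0 Y) := by
    have := (intervalIntegral.intervalIntegrable_rpow' (by linarith : -1 < c - 1) (a := 0) (b := Y))
    rwa [intervalIntegrable_iff_integrableOn_Ioc_of_le hY0.le] at this
  have h1 : IntegrableOn (fun y : ℝ => y ^ (c - 1) * (‖a y‖ ^ 2) ^ k) (Ioc 0 Y) := by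
    refine Integrable.mono' hI1 ((hcont.mono Ioc_subset_Ioi_self).aestronglyMeasurable measurableSet_Ioc) ?_
    refine (ae_restrict_iff' measurableSet_Ioc).mpr (Eventually.of_forall fun y hy => ?_)
    rw [Real.norm_of_nonneg (hnn y hy.1)]
    exact mul_le_of_le_one_right (Real.rpow_nonneg hy.1.le _) (hb1 y hy.1)
  have hv1 : ∫ y in Ioc 0 Y, y ^ (c - 1) * (‖a y‖ ^ 2) ^ k ≤ Y ^ c / c := by
    calc ∫ y in Ioc 0 Y, y ^ (c - 1) * (‖a y‖ ^ 2) ^ k ≤ ∫ y in Ioc 0 Y, y ^ (c - 1) := by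
          refine setIntegral_mono_on h1 hI1 measurableSet_Ioc fun y hy => ?_
          exact mul_le_of_le_one_right (Real.rpow_nonneg hy.1.le _) (hb1 y hy.1)
      _ = ∫ y in (0:ℝ)..Y, y ^ (c - 1) := (intervalIntegral.integral_of_le hY0.le).symm
      _ = Y ^ c / c := by
          rw [integral_rpow (Or.inl (by linarith)), show c - 1 + 1 = c by ring,
            Real.zero_rpow hc.ne', sub_zero]
  -- piece 2: `(Y, ∞)`, dominated by `Y⁸ y^{c-9}`
  have hI2 : IntegrableOn (fun y : ℝ => Y ^ 8 * y ^ (c - 9)) (Ioi Y) :=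
    (integrableOn_Ioi_rpow_of_lt (by linarith) hY0).const_mul _
  have hdom2 : ∀ y ∈ Ioi Y, y ^ (c - 1) * (‖a y‖ ^ 2) ^ k ≤ Y ^ 8 * y ^ (c - 9) := by
    intro y hy
    have hy0 : 0 < y := lt_trans hY0 hy
    calc y ^ (c - 1) * (‖a y‖ ^ 2) ^ k ≤ y ^ (c - 1) * (Y / y) ^ 8 :=
          mul_le_mul_of_nonneg_left (hb2 y hy0) (Real.rpow_nonneg hy0.le _)
      _ = Y ^ 8 * (y ^ (c - 1) * (y ^ (8:ℝ))⁻¹) := by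
          rw [div_pow, show (8:ℝ) = ((8:ℕ):ℝ) by norm_num, Real.rpow_natCast]; ring
      _ = Y ^ 8 * y ^ (c - 9) := by
          rw [← Real.rpow_neg hy0.le, ← Real.rpow_add hy0]; congr 2; ring
  have h2 : IntegrableOn (fun y : ℝ => y ^ (c - 1) * (‖a y‖ ^ 2) ^ k) (Ioi Y) := by
    refine Integrable.mono' hI2 ((hcont.mono (Ioi_subset_Ioi hY0.le)).aestronglyMeasurable measurableSet_Ioi) ?_
    refine (ae_restrict_iff' measurableSet_Ioi).mpr (Eventually.of_forall fun y hy => ?_)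
    rw [Real.norm_of_nonneg (hnn y (lt_trans hY0 hy))]
    exact hdom2 y hy
  have hv2 : ∫ y in Ioi Y, y ^ (c - 1) * (‖a y‖ ^ 2) ^ k ≤ Y ^ c := by
    calc ∫ y in Ioi Y, y ^ (c - 1) * (‖a y‖ ^ 2) ^ k ≤ ∫ y in Ioi Y, Y ^ 8 * y ^ (c - 9) :=
          setIntegral_mono_on h2 hI2 measurableSet_Ioi hdom2
      _ = Y ^ 8 * (-Y ^ (c - 9 + 1) / (c - 9 + 1)) := by
          rw [integral_const_mul, integral_Ioi_rpow_of_lt (by linarith) hY0]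
      _ = Y ^ c / (8 - c) := by
          have e : (Y ^ 8 : ℝ) * Y ^ (c - 9 + 1) = Y ^ c := by
            rw [show (Y ^ 8 : ℝ) = Y ^ ((8:ℕ):ℝ) by rw [Real.rpow_natCast], ← Real.rpow_add hY0]
            norm_num; ring_nf
          have hne : c - 9 + 1 ≠ 0 := by intro h; linarith
          calc Y ^ 8 * (-Y ^ (c - 9 + 1) / (c - 9 + 1)) = (Y ^ 8 * Y ^ (c - 9 + 1)) * (-1 / (c - 9 + 1)) := by ring
            _ = Y ^ c * (-1 / (c - 9 + 1)) := by rw [e]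
            _ = Y ^ c / (8 - c) := by
                have : (8 : ℝ) - c ≠ 0 := by intro h; linarith
                field_simp; ring
      _ ≤ Y ^ c := by
          rw [div_le_iff₀ (by linarith)]
          have : 0 ≤ Y ^ c := Real.rpow_nonneg hY0.le _
          nlinarith
  have hunion : Ioi (0:ℝ) = Ioc 0 Y ∪ Ioi Y := (Ioc_union_Ioi_eq_Ioi hY0.le).symm
  refine ⟨by rw [hunion]; exact h1.union h2, ?_⟩
  have hdisj : Disjoint (Ioc (0:ℝ) Y) (Ioi Y) :=
    Set.disjoint_left.mpr fun y hy hy' => absurd hy' (not_lt.mpr hy.2)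
  rw [hunion, setIntegral_union hdisj measurableSet_Ioi h1 h2]
  calc (∫ y in Ioc 0 Y, y ^ (c - 1) * (‖a y‖ ^ 2) ^ k) + ∫ y in Ioi Y, y ^ (c - 1) * (‖a y‖ ^ 2) ^ k
      ≤ Y ^ c / c + Y ^ c := add_le_add hv1 hv2
    _ = (1 / c + 1) * Y ^ c := by ring

/-- The Mellin transform of `A = |a|²` converges absolutely on `Re s = σ₀ ∈ (0, 1/2]`.
[cite: ConreyIwaniec2002, §6 (6.38)] -/
theorem mellinConvergent_normSq {σ₀ : ℝ} (hσ₀ : 0 < σ₀) (hσ₁ : σ₀ ≤ 1 / 2) :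
    MellinConvergent (fun y : ℝ => ((‖a y‖ ^ 2 : ℝ) : ℂ)) (σ₀ : ℂ) := by
  unfold MellinConvergent
  have hg := (integral_rpow_mul_normSq_pow_le hT hTY ha hσ₀ (by linarith) (le_refl 1)).1
  refine Integrable.mono' hg ?_ ?_
  · refine ContinuousOn.aestronglyMeasurable (fun y hy => ?_) measurableSet_Ioi
    have h1 : ContinuousWithinAt (fun t : ℝ => (t : ℂ) ^ ((σ₀ : ℂ) - 1)) (Ioi 0) y :=
      (Complex.continuousAt_ofReal_cpow_const y _ (Or.inr (ne_of_gt hy))).continuousWithinAt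
    have h2 : ContinuousWithinAt (fun t : ℝ => ((‖a t‖ ^ 2 : ℝ) : ℂ)) (Ioi 0) y :=
      Complex.continuous_ofReal.continuousAt.comp_continuousWithinAt
        (continuousOn_normSq_cutoff ha y hy)
    exact h1.smul h2
  · refine (ae_restrict_iff' measurableSet_Ioi).2 (Eventually.of_forall fun y hy => ?_)
    have hy' : (0:ℝ) < y := hy
    rw [norm_smul, Complex.norm_cpow_eq_rpow_re_of_pos hy', Complex.norm_real, Real.norm_eq_abs,
      abs_of_nonneg (sq_nonneg _)]
    simp

/-- **Mellin–Plancherel bound for the weight:**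
`∫_ℝ |𝓜A(σ₀+it)|² dt = 2π ∫₀^∞ y^{2σ₀-1}|a(y)|⁴ dy ≤ 2π (1/(2σ₀) + 1) Y^{2σ₀}` for `0 < σ₀ ≤ 1/2`.
[cite: ConreyIwaniec2002, §6 (6.38)] -/
theorem integral_norm_sq_mellin_normSq_le {σ₀ : ℝ} (hσ₀ : 0 < σ₀) (hσ₁ : σ₀ ≤ 1 / 2) :
    Integrable (fun t : ℝ => ‖mellin (fun y : ℝ => ((‖a y‖ ^ 2 : ℝ) : ℂ)) (σ₀ + t * I)‖ ^ 2) ∧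
      ∫ t : ℝ, ‖mellin (fun y : ℝ => ((‖a y‖ ^ 2 : ℝ) : ℂ)) (σ₀ + t * I)‖ ^ 2 ≤
        2 * π * ((1 / (2 * σ₀) + 1) * Y ^ (2 * σ₀)) := by
  have h4 := integral_rpow_mul_normSq_pow_le hT hTY ha (c := 2 * σ₀) (by linarith) (by linarith)
    (k := 2) (by norm_num)
  have hf2 : IntegrableOn (fun y : ℝ => ‖(((‖a y‖ ^ 2 : ℝ) : ℂ))‖ ^ 2 * y ^ (2 * σ₀ - 1)) (Ioi 0) := by
    refine h4.1.congr_fun (fun y _ => ?_) measurableSet_Ioi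
    simp only [Complex.norm_real, Real.norm_eq_abs, abs_of_nonneg (sq_nonneg ‖a y‖)]
    ring
  obtain ⟨hi, he⟩ := Literature.Analysis.FunctionSpaces.integral_norm_sq_mellin_eq
    (mellinConvergent_normSq hT hTY ha hσ₀ hσ₁) hf2
  refine ⟨hi, ?_⟩
  rw [he]
  gcongr
  calc ∫ y in Ioi (0:ℝ), ‖(((‖a y‖ ^ 2 : ℝ) : ℂ))‖ ^ 2 * y ^ (2 * σ₀ - 1)
      = ∫ y in Ioi (0:ℝ), y ^ (2 * σ₀ - 1) * (‖a y‖ ^ 2) ^ 2 := by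
        refine setIntegral_congr_fun measurableSet_Ioi fun y _ => ?_
        simp only [Complex.norm_real, Real.norm_eq_abs, abs_of_nonneg (sq_nonneg ‖a y‖)]
        ring
    _ ≤ (1 / (2 * σ₀) + 1) * Y ^ (2 * σ₀) := h4.2

end MellinWeight

section Pairing

/-! ### Fubini: `∫₀^∞ A(y)D(T/y)dy/y = (1/2π)∫ Φ(σ₀+it) T^{-σ₀-it} 𝓜A(σ₀+it) dt` -/

variable {K : ℝ → ℝ} (hK : IsCIKernel K) {κ ℓ ε₁ ε₂ : ℝ} {v w q : ℕ}
  (hq : Squarefree q) (hvw : v * w = q) (hκ0 : 0 ≤ κ) (hκ1 : κ ≤ 1) (hε₁ : |ε₁| ≤ 1) (hε₂ : |ε₂| ≤ 1)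
  {a : ℝ → ℂ} {T Y : ℝ} (hT : 2 ≤ T) (hTY : T ≤ Y) (ha : IsCutoff a T Y)
include hK hq hvw hκ0 hκ1 hε₁ hε₂ hT hTY ha

omit hK hq hvw hκ0 hκ1 hε₁ hε₂ hTY ha in
/-- `(T/y)^{-s}/y = T^{-s} y^{s-1}` for `T, y > 0`. [folklore] -/
private theorem div_cpow_neg_div {y : ℝ} (hy : 0 < y) (s : ℂ) :
    (((T / y : ℝ)) : ℂ) ^ (-s) / (y : ℂ) = (T : ℂ) ^ (-s) * (y : ℂ) ^ (s - 1) := by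
  have hT0 : 0 < T := by linarith
  have hy0 : (y : ℂ) ≠ 0 := Complex.ofReal_ne_zero.mpr hy.ne'
  rw [Complex.ofReal_div, div_eq_mul_inv ((T:ℂ)) (y:ℂ),
    show ((y : ℂ))⁻¹ = (((y⁻¹ : ℝ)) : ℂ) by push_cast; ring,
    Complex.mul_cpow_ofReal_nonneg hT0.le (inv_nonneg.mpr hy.le), Complex.ofReal_inv,
    Complex.inv_cpow _ _ (by rw [Complex.arg_ofReal_of_nonneg hy.le]; exact Real.pi_ne_zero.symm),
    Complex.cpow_neg, Complex.cpow_neg, inv_inv, Complex.cpow_sub _ _ hy0, Complex.cpow_one]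
  ring

/-- **Fubini pairing:** for `σ` with generating function `κℓ²(ε₁F_{v,w}+ε₂F_{w,v})ζ(s)ζ(s+1)`,
`∫₀^∞ |a(y)|² D(T/y) dy/y = (1/2π) ∫_ℝ Φ(c+it)·T^{-(c+it)}·𝓜|a|²(c+it) dt` (`0 < c ≤ 1/2`).
[cite: ConreyIwaniec2002, §6 (6.34), (6.39)] -/
theorem integral_normSq_ciD_eq {σ : ℕ → ℝ}
    (hσb : ∀ h : ℕ, 1 ≤ h → |σ h| ≤ 2 * ℓ ^ 2 * ∑ d ∈ Nat.divisors h, (d : ℝ)⁻¹)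
    (hZ : ∀ s : ℂ, 1 < s.re → LSeries (fun h : ℕ => (σ h : ℂ)) s =
      κ * ℓ ^ 2 * (ε₁ * genusZFactor v w s + ε₂ * genusZFactor w v s) *
        riemannZeta s * riemannZeta (s + 1))
    {c : ℝ} (hc0 : 0 < c) (hc2 : c ≤ 1 / 2) :
    (((∫ y in Ioi (0:ℝ), ‖a y‖ ^ 2 * ciD K σ (T / y) / y : ℝ)) : ℂ) =
      (1 / (2 * π) : ℂ) * ∫ t : ℝ, genusPhi K κ ℓ ε₁ ε₂ v w (c + t * I) *
        ((T : ℂ) ^ (-((c : ℂ) + t * I)) * mellin (fun y : ℝ => ((‖a y‖ ^ 2 : ℝ) : ℂ)) (c + t * I)) := by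
  have hT0 : 0 < T := by linarith
  set Φ : ℝ → ℂ := fun t => genusPhi K κ ℓ ε₁ ε₂ v w (c + t * I) with hΦ
  set A : ℝ → ℂ := fun y => ((‖a y‖ ^ 2 : ℝ) : ℂ) with hA
  -- the two-variable integrand
  set G : ℝ → ℝ → ℂ := fun y t =>
    A y / (y : ℂ) * ((1 / (2 * π) : ℂ) * ((((T / y : ℝ)) : ℂ) ^ (-((c : ℂ) + t * I)) * Φ t)) with hG
  -- Step 1: the left side is `∫_{y>0} ∫_t G y t`
  have hstep1 : (((∫ y in Ioi (0:ℝ), ‖a y‖ ^ 2 * ciD K σ (T / y) / y : ℝ)) : ℂ) =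
      ∫ y in Ioi (0:ℝ), ∫ t : ℝ, G y t := by
    rw [← integral_complex_ofReal]
    refine setIntegral_congr_fun measurableSet_Ioi fun y hy => ?_
    have hy' : (0:ℝ) < y := hy
    have hD := ciD_eq_mellinInv_genusPhi hK hq hvw hκ0 hκ1 hε₁ hε₂ hσb hZ hc0 hc2 (div_pos hT0 hy')
    simp only [hG]
    rw [integral_const_mul, integral_const_mul, Complex.ofReal_div, Complex.ofReal_mul, hD]
    unfold mellinInv
    simp only [hΦ, hA, smul_eq_mul, Complex.real_smul]
    push_cast
    ring
  -- Step 2: integrability of `G` on `(0,∞) × ℝ`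
  have hAint := (integral_rpow_mul_normSq_pow_le hT hTY ha hc0 (by linarith) (le_refl 1)).1
  have hΦint : Integrable Φ := verticalIntegrable_genusPhi hK hq hvw hκ0 hκ1 hε₁ hε₂ hc0 hc2
  have hGint : Integrable (Function.uncurry G) ((volume.restrict (Ioi (0:ℝ))).prod volume) := by
    have hprod : Integrable (fun z : ℝ × ℝ =>
        (((z.1 ^ (c - 1) * (‖a z.1‖ ^ 2) ^ 1 : ℝ)) : ℂ) * (((1 / (2 * π) * T ^ (-c) : ℝ) : ℂ) * Φ z.2))
        ((volume.restrict (Ioi (0:ℝ))).prod volume) := by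
      refine Integrable.mul_prod (f := fun y : ℝ => (((y ^ (c - 1) * (‖a y‖ ^ 2) ^ 1 : ℝ)) : ℂ))
        (g := fun t : ℝ => (((1 / (2 * π) * T ^ (-c) : ℝ) : ℂ) * Φ t)) ?_ (hΦint.const_mul _)
      exact hAint.ofReal
    have hmeas : (volume.restrict (Ioi (0:ℝ))).prod (volume : Measure ℝ) =
        ((volume : Measure ℝ).prod (volume : Measure ℝ)).restrict (Ioi 0 ×ˢ univ) := by
      rw [← Measure.restrict_univ (μ := (volume : Measure ℝ)), Measure.prod_restrict,
        Measure.restrict_univ]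
    rw [hmeas] at hprod ⊢
    refine Integrable.mono' hprod.norm ?_ ?_
    · -- measurability: `G` is continuous on `(0,∞) × ℝ`
      refine ContinuousOn.aestronglyMeasurable ?_ (measurableSet_Ioi.prod MeasurableSet.univ)
      have hΦc : Continuous Φ := continuous_genusPhi_vertical hK hc0 (by linarith)
      have hAc : ContinuousOn A (Ioi 0) :=
        Complex.continuous_ofReal.comp_continuousOn (continuousOn_normSq_cutoff ha)
      intro z hz
      have hz1 : 0 < z.1 := hz.1
      simp only [hG]
      refine ContinuousWithinAt.mul (ContinuousWithinAt.div ?_ ?_ ?_) (ContinuousWithinAt.mul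
        continuousWithinAt_const (ContinuousWithinAt.mul ?_ ?_))
      · exact (hAc z.1 hz1).comp continuous_fst.continuousWithinAt fun p hp => hp.1
      · exact (Complex.continuous_ofReal.comp continuous_fst).continuousWithinAt
      · exact Complex.ofReal_ne_zero.mpr hz1.ne'
      · -- `(T/y)^{-(c+it)}` is jointly continuous at points with `T/y > 0`
        have hbase : ContinuousAt (fun p : ℝ × ℝ => (((T / p.1 : ℝ)) : ℂ)) z :=
          (Complex.continuous_ofReal.continuousAt).comp
            ((continuousAt_const.div continuousAt_fst hz1.ne'))
        have hexp : ContinuousAt (fun p : ℝ × ℝ => -((c : ℂ) + (p.2 : ℂ) * I)) z := by fun_prop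
        refine ContinuousAt.continuousWithinAt ?_
        have hcp : ContinuousAt (fun x : ℂ × ℂ => x.1 ^ x.2)
            ((((T / z.1 : ℝ)) : ℂ), -((c : ℂ) + (z.2 : ℂ) * I)) :=
          continuousAt_cpow (Or.inl (by rw [Complex.ofReal_re]; exact div_pos hT0 hz1))
        exact hcp.comp_of_eq (hbase.prodMk hexp) rfl
      · exact (hΦc.comp continuous_snd).continuousWithinAt
    · refine (ae_restrict_iff' (measurableSet_Ioi.prod MeasurableSet.univ)).2
        (Eventually.of_forall fun z hz => ?_)
      rcases z with ⟨y, t⟩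
      have hy : (0:ℝ) < y := hz.1
      simp only [Function.uncurry, hG, hA]
      rw [norm_mul, norm_mul, norm_mul, norm_div, norm_mul, norm_mul,
        Complex.norm_cpow_eq_rpow_re_of_pos (div_pos hT0 hy)]
      simp only [Complex.neg_re, Complex.add_re, Complex.ofReal_re, Complex.mul_re, Complex.I_re,
        Complex.I_im, Complex.ofReal_im, mul_zero, sub_zero, mul_one, add_zero]
      have h1 : ‖(1 / (2 * π) : ℂ)‖ = 1 / (2 * π) := by
        rw [show (1 / (2 * π) : ℂ) = (((1 / (2 * π) : ℝ)) : ℂ) by push_cast; ring, Complex.norm_real,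
          Real.norm_eq_abs, abs_of_nonneg (by positivity)]
      have hyc : 0 < y ^ c := Real.rpow_pos_of_pos hy c
      have hTc : 0 < T ^ c := Real.rpow_pos_of_pos hT0 c
      have e3 : y ^ (c - 1) = y ^ c / y := by rw [Real.rpow_sub hy, Real.rpow_one]
      rw [Real.div_rpow hT0.le hy.le, h1]
      simp only [Complex.norm_real, Real.norm_eq_abs, abs_of_pos hy, pow_one, Real.rpow_neg hy.le,
        Real.rpow_neg hT0.le, e3, abs_of_nonneg (sq_nonneg ‖a y‖)]
      rw [abs_of_nonneg (by positivity : (0:ℝ) ≤ y ^ c / y * ‖a y‖ ^ 2),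
        abs_of_nonneg (by positivity : (0:ℝ) ≤ 1 / (2 * π) * (T ^ c)⁻¹)]
      apply le_of_eq
      field_simp
  -- Step 3: swap and evaluate the inner `y`-integral
  rw [hstep1, integral_integral_swap hGint]
  have hinner : ∀ t : ℝ, ∫ y in Ioi (0:ℝ), G y t =
      (1 / (2 * π) : ℂ) * (Φ t * ((T : ℂ) ^ (-((c : ℂ) + t * I)) * mellin A (c + t * I))) := by
    intro t
    simp only [hG]
    unfold mellin
    rw [← integral_const_mul, ← integral_const_mul, ← integral_const_mul]
    refine setIntegral_congr_fun measurableSet_Ioi fun y hy => ?_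
    have hy' : (0:ℝ) < y := hy
    have := div_cpow_neg_div hT hy' ((c : ℂ) + t * I)
    rw [smul_eq_mul]
    calc A y / (y : ℂ) * ((1 / (2 * π) : ℂ) * ((((T / y : ℝ)) : ℂ) ^ (-((c : ℂ) + t * I)) * Φ t))
        = (1 / (2 * π) : ℂ) * (Φ t * ((((T / y : ℝ)) : ℂ) ^ (-((c : ℂ) + t * I)) / (y : ℂ)) * A y) := by
          ring
      _ = (1 / (2 * π) : ℂ) * (Φ t * ((T : ℂ) ^ (-((c : ℂ) + t * I)) *
            ((y : ℂ) ^ ((c : ℂ) + t * I - 1) * A y))) := by rw [this]; ring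
  simp_rw [hinner]
  rw [integral_const_mul]

end Pairing

end OffDiagonal

end ConreyIwaniec2002

end Literature.NumberTheory.LFunctions

end
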